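import Mathlib
import Literature.Analysis.FluidPDE.ChoiEtAl2017PeriodicHouLuoKernel
import Literature.Analysis.FluidPDE.ChoiEtAl2017PeriodicHouLuoVelocity
import HarnessLib

/-!
# Choi–Hou–Kiselev–Luo–Šverák–Yao 2017, §4 proof of Theorem 1: the first functional inequality
# `−∫₀^{L/2} u θ_x cot(μx) dx ≥ (2/π) ∫₀^{L/2} θ ω cot(μy) dy`

HONEST FRAMING (cell ns-blowup GROUP B «PROFILE SEARCH», zones Z3-b′ / Z8 = the Hou–Luo boundary
MODEL): **1-D MODEL (Hou–Luo), not Euler/NS.** Proof-only companion of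
`ChoiEtAl2017PeriodicHouLuoBlowup.lean` (the fact `choiEtAl2017_periodicHouLuo_blowup`),
`…Kernel.lean` (Lemma 6) and `…Velocity.lean` (`u = Qω ∈ C¹`). Source:

* K. Choi, T. Y. Hou, A. Kiselev, G. Luo, V. Šverák, Y. Yao, Comm. Pure Appl. Math. **70** (2017)
  2218–2243 = arXiv:1407.4776 [ChoiHouKiselevLuoSverakYao2017], §4, proof of Theorem 1, p. 12
  (held text `paper:arxiv-1407.4776` p0012), first display: with `I(t) := ∫₀^{L/2} θ(t,x) cot(μx) dx`,
  "`d/dt I(t) = −∫₀^{L/2} u(t,x) θ_x(t,x) cot(μx) dx`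
   `= (1/π) ∫₀^{L/2} θ_x(t,x) ∫₀^{L/2} ω(t,y) cot(μy) K(x,y) dy dx`
   `≥ (2/π) ∫₀^{L/2} θ_x(x) ∫ₓ^{L/2} ω(t,y) cot(μy) dy dx = (2/π) ∫₀^{L/2} θ(t,y) ω(t,y) cot(μy) dy.`
   We used Lemma 6 (a), (b) in the above inequality."

## What is proved (no definitions of Prop type, no named facts; net debt 0)

The STATIC content of that display — everything after the first equality sign — for one time
slice: for `L > 0`, `ω ∈ C¹` odd `L`-periodic with `ω ≥ 0` on `[0, ½L]`, and `θ ∈ C¹` with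
`θ(0) = 0`, `θ_x ≥ 0` on `[0, ½L]` (the preserved sign structure of p. 11,
`…SignPreservation.lean`):

* `abs_le_mul_of_deriv_bounded` — `|g(y)| ≤ C·y` on `[0, ½L]` for `g ∈ C¹`, `g(0) = 0`, `|g'| ≤ C`
  (mean value theorem, private); `mul_cot_phase_le` — `y·cot(μy) ≤ L/π` on `(0, ½L)` (`tan t ≥ t`,
  private); `abs_mul_cot_phase_le` — `|ω(y)cot(μy)| ≤ C L/π`;
* `intervalIntegrable_mul_cot_phase` — `ω(y) cot(μy)` is bounded and integrable on `[0, ½L]`;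
* `two_mul_tail_le_neg_periodicHLVelocity_mul_cot` — the pointwise step
  `−u(x) cot(μx) ≥ (2/π) ∫ₓ^{L/2} ω(y) cot(μy) dy` on `(0, ½L)` (Lemma 6 (a): `K ≥ 0`, drop `[0,x]`;
  Lemma 6 (b): `K ≥ 2` on `(x, ½L)`);
* **`first_functional_inequality`** —
  `(2/π) ∫₀^{L/2} θ(y) ω(y) cot(μy) dy ≤ −∫₀^{L/2} u(x) θ_x(x) cot(μx) dx`
  (multiply by `θ_x ≥ 0`, integrate, and integrate by parts:
  `∫₀^{L/2} θ_x(x) ∫ₓ^{L/2} ωcot = ∫₀^{L/2} θ ω cot`, boundary terms `θ(0) = 0`, `∫_{L/2}^{L/2} = 0`);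
* `sq_integral_le_mul_integral_sq` — the Cauchy–Schwarz step `(∫ₐᵇ g)² ≤ (b − a) ∫ₐᵇ g²` used for
  `T₂` on p. 12 ("by Cauchy–Schwarz and (A2)");
* **`T2_inequality`** — `(2/L²)(∫₀^{L/2} θ cot(μx) dx)² ≤ (2/π)∫₀^{L/2} θ θ_x cot(μx) dx` for
  `θ ∈ C¹`, `θ(0) = 0`: the printed `T₂ = (μ/π)∫θ²csc² ≥ (μ/π)∫θ²cot² ≥ (μ/π)(2/L)I²`
  (integrate `(θ²cot)'`, `csc² ≥ cot²`, Cauchy–Schwarz).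
* `hasDerivAt_periodicHLVelocity_mul_cot` — `(u cot(μx))_x = u_x cot(μx) − μu/sin²(μx)` on
  `(0, ½L)`; **`T1_by_parts`** — `−∫₀^{L/2} u (θ_xω + θω_x) cot(μx) dx =
  ∫₀^{L/2} θω (u cot(μx))_x dx` (`ω ∈ C¹` odd periodic, `θ ∈ C¹`, `θ(0) = 0`): the `T₁` term.

With these, the printed chain on p. 12 reads, for one time slice of a smooth symmetric solution:
`dI/dt = −∫ uθ_x cot ≥ J := (2/π)∫θω cot` (`first_functional_inequality`) and
`dJ/dt = (2/π)[−∫ u(θω)_x cot + ∫ θθ_x cot] = T₁ + T₂` (`T1_by_parts`), `T₂ ≥ (2/L²) I²`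
(`T2_inequality`); the remaining printed input is Lemma 7 (`T₁ ≥ 0`).

The time derivative `d/dt I = −∫ u θ_x cot` itself (differentiation under the integral sign along a
classical solution) belongs to the assembly stage.

WHAT THIS IS NOT: not Euler, not Navier–Stokes; no blow-up is asserted here — one inequality of the
printed blow-up proof for the 1-D periodic wall MODEL. `violates:` none — MODEL.
-/

noncomputable section

open Set Filter Real MeasureTheory intervalIntegral
open _root_.Topology

namespace Literature.Analysis.FluidPDE

namespace ChoiEtAl2017

/-! ### §1 Elementary bounds: `|g(y)| ≤ C y`, `y cot(μy) ≤ L/π`, integrability of `ω cot(μ·)` -/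

/-- Mean value bound: `g ∈ C¹`, `g(0) = 0`, `|g'| ≤ C` on `[0, b]` ⇒ `|g(y)| ≤ C·y` on `[0, b]`.
[folklore] -/
private theorem abs_le_mul_of_deriv_bounded {g : ℝ → ℝ} {C b : ℝ} (hg : ContDiff ℝ 1 g)
    (hg0 : g 0 = 0) (hC : ∀ y ∈ Icc 0 b, |deriv g y| ≤ C) {y : ℝ} (hy : y ∈ Icc 0 b) :
    |g y| ≤ C * y := by
  rcases eq_or_lt_of_le hy.1 with h | h
  · rw [← h, hg0]; simp
  have hdiff : Differentiable ℝ g := hg.differentiable (by norm_num)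
  obtain ⟨c, hc, hslope⟩ := exists_deriv_eq_slope g h hdiff.continuous.continuousOn
    (hdiff.differentiableOn)
  rw [hg0, sub_zero, sub_zero] at hslope
  have hgc : g y = deriv g c * y := by rw [hslope]; field_simp
  rw [hgc, abs_mul, abs_of_pos h]
  exact mul_le_mul_of_nonneg_right (hC c ⟨hc.1.le, hc.2.le.trans hy.2⟩) h.le

/-- The phase `μy = πy/L ∈ (0, π/2)` for `y ∈ (0, ½L)`. [folklore] -/
private theorem phase_mem_Ioo' {L y : ℝ} (hL : 0 < L) (hy : y ∈ Ioo 0 (L / 2)) :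
    π * y / L ∈ Ioo 0 (π / 2) := by
  constructor
  · exact div_pos (mul_pos Real.pi_pos hy.1) hL
  · rw [div_lt_iff₀ hL]; nlinarith [hy.2, Real.pi_pos]

/-- `cot(μy) ≥ 0` for `y ∈ [0, ½L]` (junk value `0` at `y = 0`). [folklore] -/
private theorem cot_phase_nonneg' {L y : ℝ} (hL : 0 < L) (hy : y ∈ Icc 0 (L / 2)) :
    0 ≤ Real.cot (π * y / L) := by
  rw [Real.cot_eq_cos_div_sin]
  refine div_nonneg (Real.cos_nonneg_of_mem_Icc ⟨?_, ?_⟩) (Real.sin_nonneg_of_nonneg_of_le_pi ?_ ?_)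
  · have : 0 ≤ π * y / L := div_nonneg (mul_nonneg Real.pi_pos.le hy.1) hL.le
    linarith [Real.pi_pos]
  · rw [div_le_iff₀ hL]; nlinarith [hy.2, Real.pi_pos]
  · exact div_nonneg (mul_nonneg Real.pi_pos.le hy.1) hL.le
  · rw [div_le_iff₀ hL]; nlinarith [hy.2, hy.1, Real.pi_pos]

/-- **`y·cot(μy) ≤ L/π` on `(0, ½L)`** (`tan t ≥ t` on `[0, π/2)`). [folklore] -/
private theorem mul_cot_phase_le {L y : ℝ} (hL : 0 < L) (hy : y ∈ Ioo 0 (L / 2)) :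
    y * Real.cot (π * y / L) ≤ L / π := by
  have hph := phase_mem_Ioo' hL hy
  have htan : 0 < Real.tan (π * y / L) := Real.tan_pos_of_pos_of_lt_pi_div_two hph.1 hph.2
  have hle : π * y / L ≤ Real.tan (π * y / L) := Real.le_tan hph.1.le hph.2
  have hcot : Real.cot (π * y / L) = 1 / Real.tan (π * y / L) := by
    rw [Real.cot_eq_cos_div_sin, Real.tan_eq_sin_div_cos, one_div, inv_div]
  rw [hcot]
  rw [mul_one_div, div_le_div_iff₀ htan Real.pi_pos]
  calc y * π = π * y / L * L := by field_simp
    _ ≤ Real.tan (π * y / L) * L := mul_le_mul_of_nonneg_right hle hL.le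
    _ = L * Real.tan (π * y / L) := mul_comm _ _

/-- Measurability of `y ↦ g(y)·cot(μy)` for continuous `g`. [folklore] -/
private theorem measurable_mul_cot_phase {g : ℝ → ℝ} (hg : Continuous g) (L : ℝ) :
    Measurable fun y => g y * Real.cot (π * y / L) := by
  have h : (fun y => g y * Real.cot (π * y / L)) =
      fun y => g y * (Real.cos (π * y / L) / Real.sin (π * y / L)) :=
    funext fun y => by rw [Real.cot_eq_cos_div_sin]
  rw [h]
  exact hg.measurable.mul ((Real.continuous_cos.measurable.comp (by fun_prop)).div
    (Real.continuous_sin.measurable.comp (by fun_prop)))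

/-- **`ω(y) cot(μy)` is bounded on `[0, ½L]`**: for `ω ∈ C¹` with `ω(0) = 0`,
`|ω(y) cot(μy)| ≤ C·L/π` where `|ω'| ≤ C` on `[0, ½L]` — the finiteness of the weighted integrals
`∫₀^{L/2} ω cot(μy) dy`, `∫₀^{L/2} θ cot(μx) dx` used throughout the proof of Theorem 1 (odd data
vanish at `0`, `cot(μy) ~ 1/(μy)`).
[cite: ChoiHouKiselevLuoSverakYao2017, §4 proof of Thm 1, p. 12 (the weighted integrals ∫ ω cot(μy), ∫ θ cot(μx) are finite)] -/
theorem abs_mul_cot_phase_le {L : ℝ} (hL : 0 < L) {ω : ℝ → ℝ} {C : ℝ} (hω : ContDiff ℝ 1 ω)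
    (hω0 : ω 0 = 0) (hC : ∀ y ∈ Icc 0 (L / 2), |deriv ω y| ≤ C) {y : ℝ}
    (hy : y ∈ Icc 0 (L / 2)) : |ω y * Real.cot (π * y / L)| ≤ C * (L / π) := by
  have hC0 : 0 ≤ C := (abs_nonneg _).trans (hC 0 ⟨le_rfl, by linarith⟩)
  rcases eq_or_lt_of_le hy.1 with h0 | h0
  · rw [← h0, hω0, zero_mul, abs_zero]; positivity
  rcases eq_or_lt_of_le hy.2 with h2 | h2
  · rw [h2, show π * (L / 2) / L = π / 2 by field_simp, Real.cot_eq_cos_div_sin, Real.cos_pi_div_two,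
      zero_div, mul_zero, abs_zero]
    positivity
  have hyo : y ∈ Ioo 0 (L / 2) := ⟨h0, h2⟩
  rw [abs_mul, abs_of_nonneg (cot_phase_nonneg' hL hy)]
  calc |ω y| * Real.cot (π * y / L) ≤ C * y * Real.cot (π * y / L) :=
        mul_le_mul_of_nonneg_right (abs_le_mul_of_deriv_bounded hω hω0 hC hy)
          (cot_phase_nonneg' hL hy)
    _ = C * (y * Real.cot (π * y / L)) := by ring
    _ ≤ C * (L / π) := mul_le_mul_of_nonneg_left (mul_cot_phase_le hL hyo) hC0

/-- A bound for `|ω'|` on `[0, ½L]` exists for `ω ∈ C¹`. [folklore] -/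
private theorem exists_deriv_bound {ω : ℝ → ℝ} (hω : ContDiff ℝ 1 ω) (a b : ℝ) :
    ∃ C, ∀ y ∈ Icc a b, |deriv ω y| ≤ C := by
  obtain ⟨C, hC⟩ := isCompact_Icc.exists_bound_of_continuousOn
    ((hω.continuous_deriv le_rfl).continuousOn (s := Icc a b))
  exact ⟨C, fun y hy => by simpa [Real.norm_eq_abs] using hC y hy⟩

/-- **`ω(y) cot(μy)` is integrable on `[0, ½L]`** for `ω ∈ C¹` with `ω(0) = 0` (bounded and
measurable) — the integrals `∫₀^{L/2} ω(t,y) cot(μy) dy` of the first display on p. 12 make sense.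
[cite: ChoiHouKiselevLuoSverakYao2017, §4 proof of Thm 1, p. 12 (∫₀^{L/2} ω cot(μy) dy is finite)] -/
theorem intervalIntegrable_mul_cot_phase {L : ℝ} (hL : 0 < L) {ω : ℝ → ℝ} (hω : ContDiff ℝ 1 ω)
    (hω0 : ω 0 = 0) :
    IntervalIntegrable (fun y => ω y * Real.cot (π * y / L)) volume 0 (L / 2) := by
  obtain ⟨C, hC⟩ := exists_deriv_bound hω 0 (L / 2)
  refine (intervalIntegrable_const (c := C * (L / π))).mono_fun'
    (measurable_mul_cot_phase hω.continuous L).aestronglyMeasurable ?_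
  refine (ae_restrict_mem (measurableSet_uIoc)).mono fun y hy => ?_
  rw [uIoc_of_le (by linarith : (0 : ℝ) ≤ L / 2)] at hy
  dsimp only
  rw [Real.norm_eq_abs]
  exact abs_mul_cot_phase_le hL hω hω0 hC ⟨hy.1.le, hy.2⟩

/-- Continuity of `y ↦ g(y) cot(μy)` at interior points `y ∈ (0, ½L)`. [folklore] -/
private theorem continuousAt_mul_cot_phase {L : ℝ} (hL : 0 < L) {g : ℝ → ℝ} (hg : Continuous g)
    {y : ℝ} (hy : y ∈ Ioo 0 (L / 2)) :
    ContinuousAt (fun y => g y * Real.cot (π * y / L)) y := by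
  have h : (fun y => g y * Real.cot (π * y / L)) =
      fun y => g y * (Real.cos (π * y / L) / Real.sin (π * y / L)) :=
    funext fun y => by rw [Real.cot_eq_cos_div_sin]
  rw [h]
  have hph := phase_mem_Ioo' hL hy
  have hsin : Real.sin (π * y / L) ≠ 0 :=
    (Real.sin_pos_of_pos_of_lt_pi hph.1 (by linarith [hph.2, Real.pi_pos])).ne'
  exact hg.continuousAt.mul (((Real.continuous_cos.comp (by fun_prop)).continuousAt).div
    ((Real.continuous_sin.comp (by fun_prop)).continuousAt) hsin)

/-! ### §2 The pointwise step: `−u(x) cot(μx) ≥ (2/π) ∫ₓ^{L/2} ω cot(μy) dy` (Lemma 6 (a), (b)) -/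

/-- **Lemma 6 (a)+(b) ⇒ the pointwise lower bound** (p. 12, the "≥" of the first display): for
`ω ∈ C¹` odd `L`-periodic with `ω ≥ 0` on `[0, ½L]`, `u = Qω`, and `x ∈ (0, ½L)`,
`2 ∫ₓ^{L/2} ω(y) cot(μy) dy ≤ −π · u(x) cot(μx)`
(`−π u(x)cot(μx) = ∫₀^{L/2} K(x,y) ω(y)cot(μy) dy ≥ ∫ₓ^{L/2} K ωcot ≥ ∫ₓ^{L/2} 2 ωcot`).
[cite: ChoiHouKiselevLuoSverakYao2017, §4 proof of Thm 1, p. 12 (first display, "We used Lemma 6 (a), (b)")] -/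
theorem two_mul_tail_le_neg_periodicHLVelocity_mul_cot {L : ℝ} (hL : 0 < L) {ω : ℝ → ℝ}
    (hω : ContDiff ℝ 1 ω) (hodd : ∀ y, ω (-y) = -ω y) (hper : Function.Periodic ω L)
    (hnn : ∀ y ∈ Icc 0 (L / 2), 0 ≤ ω y) {x : ℝ} (hx : x ∈ Ioo 0 (L / 2)) :
    2 * ∫ y in x..L / 2, ω y * Real.cot (π * y / L) ≤
      -(π * (periodicHLVelocity L ω x * Real.cot (π * x / L))) := by
  have hω0 : ω 0 = 0 := by have h := hodd 0; rw [neg_zero] at h; linarith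
  have hxL : x ≤ L / 2 := hx.2.le
  set F : ℝ → ℝ := fun y => hlKernel L x y * (ω y * Real.cot (π * y / L)) with hF
  have hFint : IntervalIntegrable F volume 0 (L / 2) :=
    intervalIntegrable_kernelIntegrand hL hω.continuous hx
  have hFsub : IntervalIntegrable F volume x (L / 2) :=
    hFint.mono_set (by
      rw [uIcc_of_le hxL, uIcc_of_le (by linarith : (0 : ℝ) ≤ L / 2)]
      exact Icc_subset_Icc hx.1.le le_rfl)
  -- (1) drop `[0, x]` (Lemma 6 (a): the integrand is `≥ 0`)
  have h1 : ∫ y in x..L / 2, F y ≤ ∫ y in (0 : ℝ)..L / 2, F y := by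
    refine intervalIntegral.integral_mono_interval hx.1.le hxL le_rfl ?_ hFint
    refine ae_restrict_of_forall_mem measurableSet_Ioc fun y hy => ?_
    exact kernelIntegrand_nonneg hL hnn hx ⟨hy.1.le, hy.2⟩
  -- (2) `K ≥ 2` on `(x, ½L)` (Lemma 6 (b))
  have hfint : IntervalIntegrable (fun y => ω y * Real.cot (π * y / L)) volume x (L / 2) :=
    (intervalIntegrable_mul_cot_phase hL hω hω0).mono_set (by
      rw [uIcc_of_le hxL, uIcc_of_le (by linarith : (0 : ℝ) ≤ L / 2)]
      exact Icc_subset_Icc hx.1.le le_rfl)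
  have h2 : ∫ y in x..L / 2, 2 * (ω y * Real.cot (π * y / L)) ≤ ∫ y in x..L / 2, F y := by
    refine intervalIntegral.integral_mono_on_of_le_Ioo hxL (hfint.const_mul 2) hFsub fun y hy => ?_
    have hyo : y ∈ Ioo 0 (L / 2) := ⟨hx.1.trans hy.1, hy.2⟩
    exact mul_le_mul_of_nonneg_right (two_le_hlKernel hL hx hyo hy.1)
      (mul_nonneg (hnn y ⟨hyo.1.le, hyo.2.le⟩) (cot_phase_nonneg' hL ⟨hyo.1.le, hyo.2.le⟩))
  -- (3) Lemma 6, the representation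
  have hrep := periodicHLVelocity_mul_cot hL hω.continuous hodd hper hx
  have key : ∀ X : ℝ, -(π * (-(1 / π) * X)) = X := fun X => by
    field_simp
  have hpi : -(π * (periodicHLVelocity L ω x * Real.cot (π * x / L))) =
      ∫ y in (0 : ℝ)..L / 2, F y := by
    rw [hrep, key]
  rw [hpi, ← intervalIntegral.integral_const_mul]
  exact h2.trans h1

/-! ### §3 The first functional inequality (integrate against `θ_x ≥ 0`, integrate by parts) -/

/-- **The first functional inequality of the proof of Theorem 1** (p. 12, first display, static
form): for `L > 0`, `ω ∈ C¹` odd `L`-periodic with `ω ≥ 0` on `[0, ½L]`, `u = Qω`, and `θ ∈ C¹`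
with `θ(0) = 0` and `θ_x ≥ 0` on `[0, ½L]`,
`(2/π) ∫₀^{L/2} θ(y) ω(y) cot(μy) dy ≤ −∫₀^{L/2} u(x) θ_x(x) cot(μx) dx`.
Along a classical solution the right-hand side is `d/dt ∫₀^{L/2} θ cot(μx) dx` (by `θ_t = −uθ_x`),
so this is "`d/dt I(t) ≥ (2/π)∫₀^{L/2} θω cot(μy) dy`". Proof as printed: the pointwise step
`two_mul_tail_le_neg_periodicHLVelocity_mul_cot` times `θ_x ≥ 0`, integrated over `[0, ½L]`, then
`∫₀^{L/2} θ_x(x) ∫ₓ^{L/2} ωcot dy dx = ∫₀^{L/2} θ ω cot dy` by parts (`θ(0) = 0`).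
[cite: ChoiHouKiselevLuoSverakYao2017, §4 proof of Thm 1, p. 12 (first display: dI/dt ≥ (2/π)∫θω cot(μy)dy)] -/
theorem first_functional_inequality {L : ℝ} (hL : 0 < L) {ω θ : ℝ → ℝ} (hω : ContDiff ℝ 1 ω)
    (hodd : ∀ y, ω (-y) = -ω y) (hper : Function.Periodic ω L)
    (hωnn : ∀ y ∈ Icc 0 (L / 2), 0 ≤ ω y) (hθ : ContDiff ℝ 1 θ) (hθ0 : θ 0 = 0)
    (hθx : ∀ x ∈ Icc 0 (L / 2), 0 ≤ deriv θ x) :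
    2 / π * ∫ y in (0 : ℝ)..L / 2, θ y * (ω y * Real.cot (π * y / L)) ≤
      -∫ x in (0 : ℝ)..L / 2,
        periodicHLVelocity L ω x * deriv θ x * Real.cot (π * x / L) := by
  have hL2 : (0 : ℝ) ≤ L / 2 := by linarith
  have hω0 : ω 0 = 0 := by have h := hodd 0; rw [neg_zero] at h; linarith
  set f : ℝ → ℝ := fun y => ω y * Real.cot (π * y / L) with hf
  have hfint : IntervalIntegrable f volume 0 (L / 2) := intervalIntegrable_mul_cot_phase hL hω hω0
  have hfint' : ∀ x ∈ Icc 0 (L / 2), IntervalIntegrable f volume 0 x := fun x hx =>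
    hfint.mono_set (by rw [uIcc_of_le hL2, uIcc_of_le hx.1]; exact Icc_subset_Icc le_rfl hx.2)
  -- the primitive `P(x) = ∫₀ˣ f` and the tail `∫ₓ^{L/2} f = P(½L) − P(x)`
  set P : ℝ → ℝ := fun x => ∫ y in (0 : ℝ)..x, f y with hP
  have hPcont : ContinuousOn P (Icc 0 (L / 2)) := by
    have h := intervalIntegral.continuousOn_primitive_interval (μ := volume) (f := f) (a := 0)
      (b := L / 2) (by rw [uIcc_of_le hL2]; exact (intervalIntegrable_iff_integrableOn_Icc_of_le hL2).1 hfint)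
    rwa [uIcc_of_le hL2] at h
  have hPderiv : ∀ x ∈ Ioo 0 (L / 2), HasDerivAt P (f x) x := fun x hx =>
    intervalIntegral.integral_hasDerivAt_right (hfint' x ⟨hx.1.le, hx.2.le⟩)
      (measurable_mul_cot_phase hω.continuous L).stronglyMeasurable.stronglyMeasurableAtFilter
      (continuousAt_mul_cot_phase hL hω.continuous hx)
  have htail : ∀ x ∈ Icc 0 (L / 2), ∫ y in x..L / 2, f y = P (L / 2) - P x := fun x hx =>
    (intervalIntegral.integral_interval_sub_left hfint (hfint' x hx)).symm
  -- the velocity `u = Qω ∈ C¹`, `u(0) = 0`, `|u'| ≤ U`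
  set u : ℝ → ℝ := periodicHLVelocity L ω with hu
  have hu1 : ContDiff ℝ 1 u := contDiff_periodicHLVelocity hL 1 hω hper
  have hu0 : u 0 = 0 := periodicHLVelocity_zero_pt hodd hper
  obtain ⟨U, _, hU⟩ := exists_bound_periodicHLVelocity hL hω hper
  have hθ'cont : Continuous (deriv θ) := hθ.continuous_deriv le_rfl
  obtain ⟨Cθ, hCθ⟩ := isCompact_Icc.exists_bound_of_continuousOn
    (hθ'cont.continuousOn (s := Icc (0 : ℝ) (L / 2)))
  -- (1) integrability of the left integrand `u θ' cot` (bounded by `U (L/π) Cθ`) and of the others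
  have hLint : IntervalIntegrable (fun x => u x * deriv θ x * Real.cot (π * x / L)) volume
      0 (L / 2) := by
    have hmeas : Measurable fun x => u x * deriv θ x * Real.cot (π * x / L) := by
      have h := measurable_mul_cot_phase (hu1.continuous.mul hθ'cont) L
      exact h
    refine (intervalIntegrable_const (c := U * (L / π) * Cθ)).mono_fun' hmeas.aestronglyMeasurable ?_
    refine (ae_restrict_mem measurableSet_uIoc).mono fun x hx => ?_
    rw [uIoc_of_le hL2] at hx
    have hxI : x ∈ Icc 0 (L / 2) := ⟨hx.1.le, hx.2⟩
    dsimp only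
    rw [Real.norm_eq_abs, show u x * deriv θ x * Real.cot (π * x / L) =
      (u x * Real.cot (π * x / L)) * deriv θ x by ring, abs_mul]
    have hb1 : |u x * Real.cot (π * x / L)| ≤ U * (L / π) :=
      abs_mul_cot_phase_le hL hu1 hu0 (fun y _ => (hU y).2) hxI
    have hb2 : |deriv θ x| ≤ Cθ := by simpa [Real.norm_eq_abs] using hCθ x hxI
    have hU0 : 0 ≤ U * (L / π) := le_trans (abs_nonneg _) hb1
    exact mul_le_mul hb1 hb2 (abs_nonneg _) hU0
  have hRint : IntervalIntegrable (fun x => deriv θ x * (P (L / 2) - P x)) volume 0 (L / 2) := by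
    refine ContinuousOn.intervalIntegrable ?_
    rw [uIcc_of_le hL2]
    exact hθ'cont.continuousOn.mul (continuousOn_const.sub hPcont)
  have hθf : IntervalIntegrable (fun y => θ y * f y) volume 0 (L / 2) :=
    hfint.continuousOn_mul hθ.continuous.continuousOn
  -- (2) pointwise: `2/π · θ'(x) (P(½L) − P(x)) ≤ −u θ' cot` on `(0, ½L)`
  have hpt : ∀ x ∈ Ioo 0 (L / 2),
      2 / π * (deriv θ x * (P (L / 2) - P x)) ≤ -(u x * deriv θ x * Real.cot (π * x / L)) := by
    intro x hx
    have h := two_mul_tail_le_neg_periodicHLVelocity_mul_cot hL hω hodd hper hωnn hx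
    rw [htail x ⟨hx.1.le, hx.2.le⟩] at h
    have hθ' := hθx x ⟨hx.1.le, hx.2.le⟩
    -- `2 (P(½L) − P x) ≤ −π u cot`; multiply by `θ' ≥ 0`, divide by `π`
    have h' : 2 * (P (L / 2) - P x) * deriv θ x ≤
        -(π * (u x * Real.cot (π * x / L))) * deriv θ x := mul_le_mul_of_nonneg_right h hθ'
    rw [show 2 / π * (deriv θ x * (P (L / 2) - P x)) =
      (2 * (P (L / 2) - P x) * deriv θ x) / π by ring]
    rw [div_le_iff₀ Real.pi_pos]
    calc 2 * (P (L / 2) - P x) * deriv θ x ≤ -(π * (u x * Real.cot (π * x / L))) * deriv θ x := h'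
      _ = -(u x * deriv θ x * Real.cot (π * x / L)) * π := by ring
  -- (3) integrate over `[0, ½L]`
  have hint : ∫ x in (0 : ℝ)..L / 2, 2 / π * (deriv θ x * (P (L / 2) - P x)) ≤
      ∫ x in (0 : ℝ)..L / 2, -(u x * deriv θ x * Real.cot (π * x / L)) :=
    intervalIntegral.integral_mono_on_of_le_Ioo hL2 (hRint.const_mul _) hLint.neg hpt
  rw [intervalIntegral.integral_const_mul, intervalIntegral.integral_neg] at hint
  -- (4) integration by parts: `∫ θ' (P(½L) − P) = ∫ θ f`
  have hparts : ∫ x in (0 : ℝ)..L / 2, deriv θ x * (P (L / 2) - P x) =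
      ∫ y in (0 : ℝ)..L / 2, θ y * f y := by
    have hΦ : ∫ x in (0 : ℝ)..L / 2, (deriv θ x * (P (L / 2) - P x) - θ x * f x) =
        θ (L / 2) * (P (L / 2) - P (L / 2)) - θ 0 * (P (L / 2) - P 0) := by
      refine intervalIntegral.integral_eq_sub_of_hasDerivAt_of_le hL2
        (hθ.continuous.continuousOn.mul (continuousOn_const.sub hPcont)) ?_ (hRint.sub hθf)
      intro x hx
      have hθd : HasDerivAt θ (deriv θ x) x :=
        ((hθ.differentiable (by norm_num)).differentiableAt).hasDerivAt
      have h : HasDerivAt (fun x => θ x * (P (L / 2) - P x))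
          (deriv θ x * (P (L / 2) - P x) + θ x * (0 - f x)) x :=
        hθd.mul ((hasDerivAt_const x (P (L / 2))).sub (hPderiv x hx))
      refine h.congr_deriv ?_
      ring
    rw [hθ0, sub_self, mul_zero, zero_mul, sub_zero, intervalIntegral.integral_sub hRint hθf] at hΦ
    linarith
  rw [hparts] at hint
  exact hint

/-! ### §4 The Cauchy–Schwarz step for `T₂` -/

/-- **Cauchy–Schwarz on an interval**: `(∫ₐᵇ g)² ≤ (b − a) ∫ₐᵇ g²` for `a ≤ b`, `g` and `g²`
integrable — the inequality behind "by Cauchy–Schwarz and (A2), `T₂ ≥ (μ/π)(2/L) I²(t)`" on p. 12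
(there with `g = θ cot(μx)` on `[0, ½L]`). (Expand `0 ≤ ∫ (g − m)²`, `m` the mean of `g`.)
[cite: ChoiHouKiselevLuoSverakYao2017, §4 proof of Thm 1, p. 12 (T₂ by Cauchy–Schwarz)] -/
theorem sq_integral_le_mul_integral_sq {a b : ℝ} (hab : a ≤ b) {g : ℝ → ℝ}
    (hg : IntervalIntegrable g volume a b) (hg2 : IntervalIntegrable (fun x => g x ^ 2) volume a b) :
    (∫ x in a..b, g x) ^ 2 ≤ (b - a) * ∫ x in a..b, g x ^ 2 := by
  rcases eq_or_lt_of_le hab with h | h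
  · subst h; simp
  have hba : 0 < b - a := sub_pos.2 h
  set S : ℝ := ∫ x in a..b, g x with hS
  set m : ℝ := S / (b - a) with hm
  -- `0 ≤ ∫ (g − m)² = ∫ g² − 2 m S + m² (b − a)`
  have hint : IntervalIntegrable (fun x => (g x - m) ^ 2) volume a b := by
    have h : (fun x => (g x - m) ^ 2) = fun x => g x ^ 2 - 2 * m * g x + m ^ 2 := by
      funext x; ring
    rw [h]
    exact ((hg2.sub (hg.const_mul _)).add (intervalIntegrable_const))
  have hnn : 0 ≤ ∫ x in a..b, (g x - m) ^ 2 :=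
    intervalIntegral.integral_nonneg hab fun x _ => sq_nonneg _
  have hexp : ∫ x in a..b, (g x - m) ^ 2 =
      (∫ x in a..b, g x ^ 2) - 2 * m * S + m ^ 2 * (b - a) := by
    have h : (fun x => (g x - m) ^ 2) = fun x => (g x ^ 2 - 2 * m * g x) + m ^ 2 := by
      funext x; ring
    simp_rw [h]
    rw [intervalIntegral.integral_add (hg2.sub (hg.const_mul _)) intervalIntegrable_const,
      intervalIntegral.integral_sub hg2 (hg.const_mul _), intervalIntegral.integral_const_mul,
      intervalIntegral.integral_const, smul_eq_mul]
    ring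
  rw [hexp] at hnn
  have hmS : m * (b - a) = S := by rw [hm]; field_simp
  have hkey : S ^ 2 = (2 * m * S - m ^ 2 * (b - a)) * (b - a) := by
    have : m ^ 2 * (b - a) = m * S := by rw [← hmS]; ring
    rw [this]
    nlinarith [hmS]
  rw [hkey]
  have := mul_le_mul_of_nonneg_right (show 2 * m * S - m ^ 2 * (b - a) ≤ ∫ x in a..b, g x ^ 2 by
    linarith) hba.le
  linarith [this]

/-! ### §5 The `T₂` inequality: `(2/π)∫₀^{L/2} θ θ_x cot(μx) dx ≥ (2/L²) (∫₀^{L/2} θ cot(μx) dx)²` -/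

/-- For `x ∈ (0, ½L)`: `0 < sin(μx)` and `x ≤ (L/2)·sin(μx)` (Jordan's inequality
`sin t ≥ (2/π) t` on `[0, π/2]`). [folklore] -/
private theorem le_half_mul_sin_phase {L x : ℝ} (hL : 0 < L) (hx : x ∈ Ioo 0 (L / 2)) :
    0 < Real.sin (π * x / L) ∧ x ≤ L / 2 * Real.sin (π * x / L) := by
  have hph := phase_mem_Ioo' hL hx
  refine ⟨Real.sin_pos_of_pos_of_lt_pi hph.1 (by linarith [hph.2, Real.pi_pos]), ?_⟩
  have hj : 2 / π * (π * x / L) ≤ Real.sin (π * x / L) := Real.mul_le_sin hph.1.le hph.2.le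
  have h2 : 2 / π * (π * x / L) = 2 * x / L := by field_simp
  rw [h2] at hj
  have := mul_le_mul_of_nonneg_left hj (by linarith : (0 : ℝ) ≤ L / 2)
  calc x = L / 2 * (2 * x / L) := by field_simp
    _ ≤ L / 2 * Real.sin (π * x / L) := this

/-- The derivative of `x ↦ cos(μx)/sin(μx)` on `(0, ½L)`: `−μ / sin²(μx)`, `μ = π/L`. [folklore] -/
private theorem hasDerivAt_cos_div_sin_phase {L x : ℝ} (hL : 0 < L) (hx : x ∈ Ioo 0 (L / 2)) :
    HasDerivAt (fun x => Real.cos (π * x / L) / Real.sin (π * x / L))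
      (-(π / L) / Real.sin (π * x / L) ^ 2) x := by
  have hsin := (le_half_mul_sin_phase hL hx).1
  have hμ : HasDerivAt (fun x : ℝ => π * x / L) (π / L) x := by
    have h := ((hasDerivAt_id x).const_mul π).div_const L
    simpa [mul_comm] using h
  have hc : HasDerivAt (fun x => Real.cos (π * x / L)) (-Real.sin (π * x / L) * (π / L)) x :=
    hμ.cos
  have hs : HasDerivAt (fun x => Real.sin (π * x / L)) (Real.cos (π * x / L) * (π / L)) x :=
    hμ.sin
  have h := hc.div hs hsin.ne'
  refine h.congr_deriv ?_
  have h1 : Real.sin (π * x / L) ^ 2 + Real.cos (π * x / L) ^ 2 = 1 := Real.sin_sq_add_cos_sq _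
  field_simp
  nlinarith [h1]

/-- **The `T₂` inequality of the proof of Theorem 1** (p. 12: "`T₂ = (2/π)∫₀^{L/2} θθ_x cot(μx) dx
= (μ/π) ∫₀^{L/2} θ² csc²(μx) dx`", "by Cauchy–Schwarz and (A2) … `T₂ ≥ (μ/π)∫θ²cot²(μx) dx ≥
(μ/π)(2/L) I²(t)`", `I = ∫₀^{L/2} θ cot(μx) dx`), static form: for `L > 0` and `θ ∈ C¹` with
`θ(0) = 0`,
`(2/L²) (∫₀^{L/2} θ cot(μx) dx)² ≤ (2/π) ∫₀^{L/2} θ(x) θ_x(x) cot(μx) dx`.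
Proof as printed: integrate `(θ² cot(μx))' = 2θθ_x cot − μθ² csc²` over `[0, ½L]` (boundary terms
vanish: `θ(0) = 0`, `cot(½π) = 0`), then `csc² ≥ cot²` and Cauchy–Schwarz
(`sq_integral_le_mul_integral_sq`); `μ/π · 2/L = 2/L²`.
[cite: ChoiHouKiselevLuoSverakYao2017, §4 proof of Thm 1, p. 12 (T₂ ≥ (μ/π)(2/L) I²)] -/
theorem T2_inequality {L : ℝ} (hL : 0 < L) {θ : ℝ → ℝ} (hθ : ContDiff ℝ 1 θ) (hθ0 : θ 0 = 0) :
    2 / L ^ 2 * (∫ x in (0 : ℝ)..L / 2, θ x * Real.cot (π * x / L)) ^ 2 ≤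
      2 / π * ∫ x in (0 : ℝ)..L / 2, θ x * deriv θ x * Real.cot (π * x / L) := by
  have hL2 : (0 : ℝ) ≤ L / 2 := by linarith
  obtain ⟨C, hC⟩ := exists_deriv_bound hθ 0 (L / 2)
  have hC0 : 0 ≤ C := (abs_nonneg _).trans (hC 0 ⟨le_rfl, hL2⟩)
  have hθ'cont : Continuous (deriv θ) := hθ.continuous_deriv le_rfl
  -- notation: `q = cot(μ·)` written as `cos/sin`, `g = θ q`
  set q : ℝ → ℝ := fun x => Real.cos (π * x / L) / Real.sin (π * x / L) with hq
  have hcotq : ∀ x, Real.cot (π * x / L) = q x := fun x => Real.cot_eq_cos_div_sin _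
  simp_rw [hcotq]
  -- bounds on `[0, ½L]`: `|θ q| ≤ C L/π`, `θ²/sin² ≤ C² L²/4`
  have hθq : ∀ x ∈ Icc 0 (L / 2), |θ x * q x| ≤ C * (L / π) := fun x hx => by
    rw [← hcotq]; exact abs_mul_cot_phase_le hL hθ hθ0 hC hx
  have hθabs : ∀ x ∈ Icc 0 (L / 2), |θ x| ≤ C * x := fun x hx =>
    abs_le_mul_of_deriv_bounded hθ hθ0 hC hx
  -- measurability
  have hqm : Measurable q := (Real.continuous_cos.measurable.comp (by fun_prop)).div
    (Real.continuous_sin.measurable.comp (by fun_prop))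
  have hθm : Measurable θ := hθ.continuous.measurable
  -- integrability of `g = θ q`, `g²`, `θ θ' q`, `θ²/sin²`
  have hgint : IntervalIntegrable (fun x => θ x * q x) volume 0 (L / 2) := by
    have h := intervalIntegrable_mul_cot_phase hL hθ hθ0
    exact h.congr fun x _ => by simp only [hcotq]
  have hbdd_int : ∀ {F : ℝ → ℝ} (K : ℝ), Measurable F → (∀ x ∈ Ioc 0 (L / 2), |F x| ≤ K) →
      IntervalIntegrable F volume 0 (L / 2) := by
    intro F K hF hK
    refine (intervalIntegrable_const (c := K)).mono_fun' hF.aestronglyMeasurable ?_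
    refine (ae_restrict_mem measurableSet_uIoc).mono fun x hx => ?_
    rw [uIoc_of_le hL2] at hx
    dsimp only
    rw [Real.norm_eq_abs]
    exact hK x hx
  -- pointwise facts on `(0, ½L]`
  have hsin_pos : ∀ x ∈ Ioc 0 (L / 2), 0 < Real.sin (π * x / L) := by
    intro x hx
    rcases eq_or_lt_of_le hx.2 with h | h
    · rw [h, show π * (L / 2) / L = π / 2 by field_simp, Real.sin_pi_div_two]; norm_num
    · exact (le_half_mul_sin_phase hL ⟨hx.1, h⟩).1
  have hx_sin : ∀ x ∈ Ioc 0 (L / 2), x ≤ L / 2 * Real.sin (π * x / L) := by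
    intro x hx
    rcases eq_or_lt_of_le hx.2 with h | h
    · rw [h, show π * (L / 2) / L = π / 2 by field_simp, Real.sin_pi_div_two]; linarith
    · exact (le_half_mul_sin_phase hL ⟨hx.1, h⟩).2
  have hθsin : ∀ x ∈ Ioc 0 (L / 2), θ x ^ 2 / Real.sin (π * x / L) ^ 2 ≤ (C * (L / 2)) ^ 2 := by
    intro x hx
    have hs := hsin_pos x hx
    have h1 : |θ x| ≤ C * x := hθabs x ⟨hx.1.le, hx.2⟩
    have h2 : C * x ≤ C * (L / 2 * Real.sin (π * x / L)) :=
      mul_le_mul_of_nonneg_left (hx_sin x hx) hC0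
    have h3 : |θ x| ≤ C * (L / 2) * Real.sin (π * x / L) := by nlinarith
    rw [div_le_iff₀ (pow_pos hs 2), ← mul_pow]
    have h4 : |θ x| ^ 2 ≤ (C * (L / 2) * Real.sin (π * x / L)) ^ 2 :=
      pow_le_pow_left₀ (abs_nonneg _) h3 2
    rw [sq_abs] at h4
    exact h4
  have hg2int : IntervalIntegrable (fun x => (θ x * q x) ^ 2) volume 0 (L / 2) := by
    refine hbdd_int ((C * (L / π)) ^ 2) ((hθm.mul hqm).pow_const 2) fun x hx => ?_
    rw [abs_pow, ← sq_abs]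
    exact pow_le_pow_left₀ (abs_nonneg _) (by rw [abs_abs]; exact hθq x ⟨hx.1.le, hx.2⟩) 2
  have hcsc_int : IntervalIntegrable (fun x => θ x ^ 2 / Real.sin (π * x / L) ^ 2) volume
      0 (L / 2) := by
    refine hbdd_int ((C * (L / 2)) ^ 2) ((hθm.pow_const 2).div
      ((Real.continuous_sin.measurable.comp (by fun_prop)).pow_const 2)) fun x hx => ?_
    rw [abs_of_nonneg (div_nonneg (sq_nonneg _) (sq_nonneg _))]
    exact hθsin x hx
  have hTint : IntervalIntegrable (fun x => θ x * deriv θ x * q x) volume 0 (L / 2) := by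
    have h := hgint.mul_continuousOn (hθ'cont.continuousOn (s := uIcc 0 (L / 2)))
    exact h.congr fun x _ => by ring
  -- (1) `Φ = θ² q` is continuous on `[0, ½L]` (at `0` by the squeeze `|Φ| ≤ C (L/π) |θ|`)
  set Φ : ℝ → ℝ := fun x => θ x ^ 2 * q x with hΦ
  have hΦcont : ContinuousOn Φ (Icc 0 (L / 2)) := by
    intro x hx
    rcases eq_or_lt_of_le hx.1 with h0 | h0
    · -- at `x = 0`
      rw [← h0]
      have hΦ0 : Φ 0 = 0 := by simp [hΦ, hθ0]
      have hbound : ∀ y ∈ Icc 0 (L / 2), |Φ y| ≤ C * (L / π) * |θ y| := by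
        intro y hy
        rw [hΦ]; dsimp only
        rw [show θ y ^ 2 * q y = θ y * (θ y * q y) by ring, abs_mul, mul_comm]
        exact mul_le_mul_of_nonneg_right (hθq y hy) (abs_nonneg _)
      have hlim : Tendsto (fun y => C * (L / π) * |θ y|) (𝓝[Icc 0 (L / 2)] 0) (𝓝 0) := by
        have hc : Continuous fun y => C * (L / π) * |θ y| :=
          continuous_const.mul (continuous_abs.comp hθ.continuous)
        have h := (hc.tendsto 0).mono_left (nhdsWithin_le_nhds (s := Icc 0 (L / 2)))
        simpa [hθ0] using h
      have ht : Tendsto Φ (𝓝[Icc 0 (L / 2)] 0) (𝓝 0) :=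
        squeeze_zero_norm' (eventually_nhdsWithin_of_forall fun y hy => by
          rw [Real.norm_eq_abs]; exact hbound y hy) hlim
      rw [ContinuousWithinAt, hΦ0]
      exact ht
    · have hxI : x ∈ Ioc 0 (L / 2) := ⟨h0, hx.2⟩
      have hcq : ContinuousAt q x :=
        ((Real.continuous_cos.comp (by fun_prop)).continuousAt).div
          ((Real.continuous_sin.comp (by fun_prop)).continuousAt) (hsin_pos x hxI).ne'
      exact (((hθ.continuous.pow 2).continuousAt).mul hcq).continuousWithinAt
  -- (2) `Φ' = 2 θ θ' q − μ θ²/sin²` on `(0, ½L)`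
  have hΦderiv : ∀ x ∈ Ioo 0 (L / 2), HasDerivAt Φ
      (2 * (θ x * deriv θ x * q x) - π / L * (θ x ^ 2 / Real.sin (π * x / L) ^ 2)) x := by
    intro x hx
    have hθd : HasDerivAt θ (deriv θ x) x :=
      ((hθ.differentiable (by norm_num)).differentiableAt).hasDerivAt
    have hθ2 : HasDerivAt (fun y => θ y ^ 2) (2 * θ x * deriv θ x) x := by
      have h := hθd.pow 2
      refine h.congr_deriv ?_
      ring
    have h : HasDerivAt (fun y => θ y ^ 2 * q y)
        (2 * θ x * deriv θ x * q x + θ x ^ 2 * (-(π / L) / Real.sin (π * x / L) ^ 2)) x :=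
      hθ2.mul (hasDerivAt_cos_div_sin_phase hL hx)
    refine h.congr_deriv ?_
    have hs := (hsin_pos x ⟨hx.1, hx.2.le⟩).ne'
    field_simp
    ring
  -- (3) integrate: `2 ∫ θθ'q − μ ∫ θ²/sin² = Φ(½L) − Φ(0) = 0`
  have hΦ'int : IntervalIntegrable (fun x => 2 * (θ x * deriv θ x * q x) -
      π / L * (θ x ^ 2 / Real.sin (π * x / L) ^ 2)) volume 0 (L / 2) :=
    (hTint.const_mul 2).sub (hcsc_int.const_mul _)
  have hFTC := intervalIntegral.integral_eq_sub_of_hasDerivAt_of_le hL2 hΦcont hΦderiv hΦ'int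
  have hΦL : Φ (L / 2) = 0 := by
    simp only [hΦ, hq]
    rw [show π * (L / 2) / L = π / 2 by field_simp, Real.cos_pi_div_two]
    simp
  have hΦ0 : Φ 0 = 0 := by simp [hΦ, hθ0]
  rw [hΦL, hΦ0, sub_zero, intervalIntegral.integral_sub (hTint.const_mul 2) (hcsc_int.const_mul _),
    intervalIntegral.integral_const_mul, intervalIntegral.integral_const_mul] at hFTC
  -- so `2 ∫ θθ'q = (π/L) ∫ θ²/sin²`
  have hid : 2 * ∫ x in (0 : ℝ)..L / 2, θ x * deriv θ x * q x =
      π / L * ∫ x in (0 : ℝ)..L / 2, θ x ^ 2 / Real.sin (π * x / L) ^ 2 := by linarith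
  -- (4) `csc² ≥ cot²`
  have h4 : ∫ x in (0 : ℝ)..L / 2, (θ x * q x) ^ 2 ≤
      ∫ x in (0 : ℝ)..L / 2, θ x ^ 2 / Real.sin (π * x / L) ^ 2 := by
    refine intervalIntegral.integral_mono_on hL2 hg2int hcsc_int fun x hx => ?_
    rcases eq_or_lt_of_le hx.1 with h0 | h0
    · rw [← h0, hθ0]; simp
    have hs := hsin_pos x ⟨h0, hx.2⟩
    rw [hq]; dsimp only
    rw [mul_pow, div_pow]
    rw [← mul_div_assoc, div_le_div_iff_of_pos_right (pow_pos hs 2)]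
    have hc : Real.cos (π * x / L) ^ 2 ≤ 1 := Real.cos_sq_le_one _
    exact mul_le_of_le_one_right (sq_nonneg _) hc
  -- (5) Cauchy–Schwarz
  have h5 := sq_integral_le_mul_integral_sq hL2 hgint hg2int
  rw [sub_zero] at h5
  -- (6) assemble (`μ/π · 2/L = 2/L²`)
  have hπ := Real.pi_pos
  have hI : 2 / π * ∫ x in (0 : ℝ)..L / 2, θ x * deriv θ x * q x =
      1 / L * ∫ x in (0 : ℝ)..L / 2, θ x ^ 2 / Real.sin (π * x / L) ^ 2 := by
    have h := congrArg (fun z => z / π) hid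
    field_simp
    field_simp at h
    linarith
  rw [hI]
  have h6 : 2 / L ^ 2 * (∫ x in (0 : ℝ)..L / 2, θ x * q x) ^ 2 ≤
      1 / L * ∫ x in (0 : ℝ)..L / 2, (θ x * q x) ^ 2 := by
    rw [show 2 / L ^ 2 * (∫ x in (0 : ℝ)..L / 2, θ x * q x) ^ 2 =
      1 / L * (2 / L * (∫ x in (0 : ℝ)..L / 2, θ x * q x) ^ 2) by field_simp]
    refine mul_le_mul_of_nonneg_left ?_ (by positivity)
    rw [div_mul_eq_mul_div, div_le_iff₀ hL]
    calc 2 * (∫ x in (0 : ℝ)..L / 2, θ x * q x) ^ 2 ≤ 2 * (L / 2 * ∫ x in (0 : ℝ)..L / 2,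
        (θ x * q x) ^ 2) := by linarith
      _ = (∫ x in (0 : ℝ)..L / 2, (θ x * q x) ^ 2) * L := by ring
  exact h6.trans (mul_le_mul_of_nonneg_left h4 (by positivity))

/-! ### §6 The `T₁` term: `−∫₀^{L/2} u (θω)_x cot(μx) dx = ∫₀^{L/2} θω (u cot(μx))_x dx` -/

/-- **`(u cot(μx))_x` exists on `(0, ½L)`** for `u = Qω`, `ω ∈ C¹` `L`-periodic (`L > 0`):
`d/dx [u(x) cot(μx)] = u_x(x) cot(μx) − μ u(x)/sin²(μx)` — the derivative appearing in `T₁` and in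
Lemma 7 (`∫ₐ^{L/2} ω (u cot(μx))_x dx ≥ 0`).
[cite: ChoiHouKiselevLuoSverakYao2017, §4 proof of Thm 1, p. 12 (T₁ = (2/π)∫ θω (u cot(μx))_x dx)] -/
theorem hasDerivAt_periodicHLVelocity_mul_cot {L : ℝ} (hL : 0 < L) {ω : ℝ → ℝ}
    (hω : ContDiff ℝ 1 ω) (hper : Function.Periodic ω L) {x : ℝ} (hx : x ∈ Ioo 0 (L / 2)) :
    HasDerivAt (fun y => periodicHLVelocity L ω y * Real.cot (π * y / L))
      (deriv (periodicHLVelocity L ω) x * Real.cot (π * x / L) -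
        π / L * periodicHLVelocity L ω x / Real.sin (π * x / L) ^ 2) x := by
  have hu : HasDerivAt (periodicHLVelocity L ω) (deriv (periodicHLVelocity L ω) x) x := by
    have h := hasDerivAt_periodicHLVelocity hL hω hper x
    rwa [← deriv_periodicHLVelocity hL hω hper] at h
  have h := hu.mul (hasDerivAt_cos_div_sin_phase hL hx)
  refine (h.congr_of_eventuallyEq (Eventually.of_forall fun y => ?_)).congr_deriv ?_
  · simp only [Pi.mul_apply, Real.cot_eq_cos_div_sin]
  · rw [Real.cot_eq_cos_div_sin]
    ring

/-- **The `T₁` integration by parts** (p. 12: "`d/dt (2/π)∫θω cot = (2/π)∫[−u(θω)_x cot + θθ_x cot]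
= (2/π)∫ θω (u cot(μx))_x dx + (2/π)∫ θθ_x cot(μx) dx = T₁ + T₂`"), static form: for `L > 0`,
`ω ∈ C¹` odd `L`-periodic, `u = Qω`, and `θ ∈ C¹` with `θ(0) = 0`,
`−∫₀^{L/2} u (θ_x ω + θ ω_x) cot(μx) dx = ∫₀^{L/2} θ ω (u_x cot(μx) − μ u / sin²(μx)) dx`
(boundary terms vanish: `θ(0)ω(0) = 0` with `u cot` bounded, and `cot(½π) = 0`).
[cite: ChoiHouKiselevLuoSverakYao2017, §4 proof of Thm 1, p. 12 (T₁ by parts)] -/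
theorem T1_by_parts {L : ℝ} (hL : 0 < L) {ω θ : ℝ → ℝ} (hω : ContDiff ℝ 1 ω)
    (hodd : ∀ y, ω (-y) = -ω y) (hper : Function.Periodic ω L) (hθ : ContDiff ℝ 1 θ)
    (hθ0 : θ 0 = 0) :
    -∫ x in (0 : ℝ)..L / 2, periodicHLVelocity L ω x * (deriv θ x * ω x + θ x * deriv ω x) *
        Real.cot (π * x / L) =
      ∫ x in (0 : ℝ)..L / 2, θ x * ω x *
        (deriv (periodicHLVelocity L ω) x * Real.cot (π * x / L) -
          π / L * periodicHLVelocity L ω x / Real.sin (π * x / L) ^ 2) := by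
  have hL2 : (0 : ℝ) ≤ L / 2 := by linarith
  have hω0 : ω 0 = 0 := by have h := hodd 0; rw [neg_zero] at h; linarith
  set u : ℝ → ℝ := periodicHLVelocity L ω with hu
  have hu1 : ContDiff ℝ 1 u := contDiff_periodicHLVelocity hL 1 hω hper
  have hu0 : u 0 = 0 := periodicHLVelocity_zero_pt hodd hper
  obtain ⟨U, hU0, hU⟩ := exists_bound_periodicHLVelocity hL hω hper
  obtain ⟨Cθ, hCθ⟩ := exists_deriv_bound hθ 0 (L / 2)
  obtain ⟨Cω, hCω⟩ := exists_deriv_bound hω 0 (L / 2)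
  have hCθ0 : 0 ≤ Cθ := (abs_nonneg _).trans (hCθ 0 ⟨le_rfl, hL2⟩)
  have hCω0 : 0 ≤ Cω := (abs_nonneg _).trans (hCω 0 ⟨le_rfl, hL2⟩)
  have hθabs : ∀ x ∈ Icc 0 (L / 2), |θ x| ≤ Cθ * x := fun x hx =>
    abs_le_mul_of_deriv_bounded hθ hθ0 hCθ hx
  have hωabs : ∀ x ∈ Icc 0 (L / 2), |ω x| ≤ Cω * x := fun x hx =>
    abs_le_mul_of_deriv_bounded hω hω0 hCω hx
  have huabs : ∀ x ∈ Icc 0 (L / 2), |u x| ≤ U * x := fun x hx =>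
    abs_le_mul_of_deriv_bounded hu1 hu0 (fun y _ => (hU y).2) hx
  have huq : ∀ x ∈ Icc 0 (L / 2), |u x * Real.cot (π * x / L)| ≤ U * (L / π) := fun x hx =>
    abs_mul_cot_phase_le hL hu1 hu0 (fun y _ => (hU y).2) hx
  -- notation `q = cos/sin`
  set q : ℝ → ℝ := fun x => Real.cos (π * x / L) / Real.sin (π * x / L) with hq
  have hcotq : ∀ x, Real.cot (π * x / L) = q x := fun x => Real.cot_eq_cos_div_sin _
  simp_rw [hcotq]
  simp_rw [hcotq] at huq
  have hsin_pos : ∀ x ∈ Ioc 0 (L / 2), 0 < Real.sin (π * x / L) := by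
    intro x hx
    rcases eq_or_lt_of_le hx.2 with h | h
    · rw [h, show π * (L / 2) / L = π / 2 by field_simp, Real.sin_pi_div_two]; norm_num
    · exact (le_half_mul_sin_phase hL ⟨hx.1, h⟩).1
  have hx_sin : ∀ x ∈ Ioc 0 (L / 2), x ≤ L / 2 * Real.sin (π * x / L) := by
    intro x hx
    rcases eq_or_lt_of_le hx.2 with h | h
    · rw [h, show π * (L / 2) / L = π / 2 by field_simp, Real.sin_pi_div_two]; linarith
    · exact (le_half_mul_sin_phase hL ⟨hx.1, h⟩).2
  -- measurability
  have hqm : Measurable q := (Real.continuous_cos.measurable.comp (by fun_prop)).div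
    (Real.continuous_sin.measurable.comp (by fun_prop))
  have hθm : Measurable θ := hθ.continuous.measurable
  have hωm : Measurable ω := hω.continuous.measurable
  have hum : Measurable u := hu1.continuous.measurable
  have hu'm : Measurable (deriv u) := (hu1.continuous_deriv le_rfl).measurable
  have hsm : Measurable fun x => Real.sin (π * x / L) :=
    Real.continuous_sin.measurable.comp (by fun_prop)
  have hbdd_int : ∀ {F : ℝ → ℝ} (K : ℝ), Measurable F → (∀ x ∈ Ioc 0 (L / 2), |F x| ≤ K) →
      IntervalIntegrable F volume 0 (L / 2) := by
    intro F K hF hK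
    refine (intervalIntegrable_const (c := K)).mono_fun' hF.aestronglyMeasurable ?_
    refine (ae_restrict_mem measurableSet_uIoc).mono fun x hx => ?_
    rw [uIoc_of_le hL2] at hx
    dsimp only
    rw [Real.norm_eq_abs]
    exact hK x hx
  -- the derivative `V' = u' q − μ u / sin²` and the bound `|θ ω V'| ≤ K`
  set V' : ℝ → ℝ := fun x => deriv u x * q x - π / L * u x / Real.sin (π * x / L) ^ 2 with hV'
  have hV'm : Measurable V' := (hu'm.mul hqm).sub ((hum.const_mul _).div (hsm.pow_const 2))
  have hprod_bd : ∀ x ∈ Ioc 0 (L / 2), |θ x * ω x * V' x| ≤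
      Cθ * Cω * (U * (L / 2) * (L / π) + π / L * U * (L / 2) ^ 3) := by
    intro x hx
    have hxI : x ∈ Icc 0 (L / 2) := ⟨hx.1.le, hx.2⟩
    have hx0 : 0 < x := hx.1
    have hs := hsin_pos x hx
    have h1 : |θ x| ≤ Cθ * x := hθabs x hxI
    have h2 : |ω x| ≤ Cω * x := hωabs x hxI
    have h3 : |u x| ≤ U * x := huabs x hxI
    have h4 : |deriv u x| ≤ U := (hU x).2
    -- `|x q x| ≤ L/π`-type bound: `|q x| x ≤ L/π`; we use `|x · q x| ≤ L / π` via `q ≥ 0`, `x q ≤ L/π`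
    have hq0 : 0 ≤ q x := by rw [← hcotq]; exact cot_phase_nonneg' hL hxI
    have hxq : x * q x ≤ L / π := by
      rcases eq_or_lt_of_le hx.2 with h | h
      · rw [hq]; dsimp only
        rw [h, show π * (L / 2) / L = π / 2 by field_simp, Real.cos_pi_div_two, zero_div, mul_zero]
        positivity
      · rw [← hcotq]; exact mul_cot_phase_le hL ⟨hx0, h⟩
    have hxs : x ≤ L / 2 * Real.sin (π * x / L) := hx_sin x hx
    -- first piece: `|θ ω u' q| ≤ Cθ x · Cω x · U · q ≤ Cθ Cω U (L/2) (L/π)`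
    have hA : |θ x * ω x * (deriv u x * q x)| ≤ Cθ * Cω * (U * (L / 2) * (L / π)) := by
      rw [abs_mul, abs_mul, abs_mul, abs_of_nonneg hq0]
      have hθω : |θ x| * |ω x| ≤ Cθ * x * (Cω * x) :=
        mul_le_mul h1 h2 (abs_nonneg _) (by positivity)
      have hB : |deriv u x| * q x ≤ U * q x := mul_le_mul_of_nonneg_right h4 hq0
      calc |θ x| * |ω x| * (|deriv u x| * q x) ≤ Cθ * x * (Cω * x) * (U * q x) :=
            mul_le_mul hθω hB (by positivity) (by positivity)
        _ = Cθ * Cω * (U * x * (x * q x)) := by ring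
        _ ≤ Cθ * Cω * (U * (L / 2) * (L / π)) := by
            refine mul_le_mul_of_nonneg_left ?_ (by positivity)
            exact mul_le_mul (mul_le_mul_of_nonneg_left hx.2 hU0) hxq (by positivity)
              (by positivity)
    -- second piece: `|θ ω μ u / sin²| ≤ Cθ Cω U μ x³/sin² ≤ Cθ Cω U μ (L/2)³`
    have hB : |θ x * ω x * (π / L * u x / Real.sin (π * x / L) ^ 2)| ≤
        Cθ * Cω * (π / L * U * (L / 2) ^ 3) := by
      rw [abs_mul, abs_mul, abs_div, abs_mul, abs_of_pos (div_pos Real.pi_pos hL),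
        abs_of_pos (pow_pos hs 2)]
      rw [show |θ x| * |ω x| * (π / L * |u x| / Real.sin (π * x / L) ^ 2) =
        π / L * (|θ x| * |ω x| * |u x|) / Real.sin (π * x / L) ^ 2 by ring]
      rw [div_le_iff₀ (pow_pos hs 2)]
      have hθωu : |θ x| * |ω x| * |u x| ≤ Cθ * x * (Cω * x) * (U * x) :=
        mul_le_mul (mul_le_mul h1 h2 (abs_nonneg _) (by positivity)) h3 (abs_nonneg _)
          (by positivity)
      have hx3 : x ^ 3 ≤ (L / 2 * Real.sin (π * x / L)) ^ 3 :=
        pow_le_pow_left₀ hx0.le hxs 3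
      have hsle : Real.sin (π * x / L) ≤ 1 := Real.sin_le_one _
      calc π / L * (|θ x| * |ω x| * |u x|) ≤ π / L * (Cθ * x * (Cω * x) * (U * x)) :=
            mul_le_mul_of_nonneg_left hθωu (by positivity)
        _ = π / L * (Cθ * Cω * U) * x ^ 3 := by ring
        _ ≤ π / L * (Cθ * Cω * U) * (L / 2 * Real.sin (π * x / L)) ^ 3 :=
            mul_le_mul_of_nonneg_left hx3 (by positivity)
        _ = Cθ * Cω * (π / L * U * (L / 2) ^ 3) * Real.sin (π * x / L) ^ 2 *
              Real.sin (π * x / L) := by ring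
        _ ≤ Cθ * Cω * (π / L * U * (L / 2) ^ 3) * Real.sin (π * x / L) ^ 2 * 1 :=
            mul_le_mul_of_nonneg_left hsle (by positivity)
        _ = Cθ * Cω * (π / L * U * (L / 2) ^ 3) * Real.sin (π * x / L) ^ 2 := mul_one _
    rw [hV']; dsimp only
    rw [show θ x * ω x * (deriv u x * q x - π / L * u x / Real.sin (π * x / L) ^ 2) =
      θ x * ω x * (deriv u x * q x) - θ x * ω x * (π / L * u x / Real.sin (π * x / L) ^ 2) by ring]
    refine (abs_sub _ _).trans ?_
    rw [mul_add]
    exact add_le_add hA hB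
  have hRint : IntervalIntegrable (fun x => θ x * ω x * V' x) volume 0 (L / 2) :=
    hbdd_int _ ((hθm.mul hωm).mul hV'm) hprod_bd
  -- the left integrand `u (θ'ω + θω') q = (u q) · (θ'ω + θω')`: bounded × continuous
  have huqint : IntervalIntegrable (fun x => u x * q x) volume 0 (L / 2) :=
    hbdd_int _ (hum.mul hqm) fun x hx => huq x ⟨hx.1.le, hx.2⟩
  have hDcont : Continuous fun x => deriv θ x * ω x + θ x * deriv ω x :=
    ((hθ.continuous_deriv le_rfl).mul hω.continuous).add
      (hθ.continuous.mul (hω.continuous_deriv le_rfl))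
  have hLint : IntervalIntegrable (fun x => u x * (deriv θ x * ω x + θ x * deriv ω x) * q x)
      volume 0 (L / 2) := by
    have h := huqint.mul_continuousOn (hDcont.continuousOn (s := uIcc 0 (L / 2)))
    exact h.congr fun x _ => by ring
  -- (1) `Φ = θ ω (u q)` is continuous on `[0, ½L]`
  set Φ : ℝ → ℝ := fun x => θ x * ω x * (u x * q x) with hΦ
  have hΦ0 : Φ 0 = 0 := by simp [hΦ, hθ0]
  have hΦcont : ContinuousOn Φ (Icc 0 (L / 2)) := by
    intro x hx
    rcases eq_or_lt_of_le hx.1 with h0 | h0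
    · rw [← h0]
      have hbound : ∀ y ∈ Icc 0 (L / 2), |Φ y| ≤ U * (L / π) * Cω * (L / 2) * |θ y| := by
        intro y hy
        rw [hΦ]; dsimp only
        rw [abs_mul, abs_mul]
        have h1 := huq y hy
        have h2 : |ω y| ≤ Cω * (L / 2) := (hωabs y hy).trans
          (mul_le_mul_of_nonneg_left hy.2 hCω0)
        calc |θ y| * |ω y| * |u y * q y| ≤ |θ y| * (Cω * (L / 2)) * (U * (L / π)) :=
              mul_le_mul (mul_le_mul_of_nonneg_left h2 (abs_nonneg _)) h1 (abs_nonneg _)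
                (by positivity)
          _ = U * (L / π) * Cω * (L / 2) * |θ y| := by ring
      have hlim : Tendsto (fun y => U * (L / π) * Cω * (L / 2) * |θ y|) (𝓝[Icc 0 (L / 2)] 0)
          (𝓝 0) := by
        have hc : Continuous fun y => U * (L / π) * Cω * (L / 2) * |θ y| :=
          continuous_const.mul (continuous_abs.comp hθ.continuous)
        have h := (hc.tendsto 0).mono_left (nhdsWithin_le_nhds (s := Icc 0 (L / 2)))
        simpa [hθ0] using h
      have ht : Tendsto Φ (𝓝[Icc 0 (L / 2)] 0) (𝓝 0) :=
        squeeze_zero_norm' (eventually_nhdsWithin_of_forall fun y hy => by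
          rw [Real.norm_eq_abs]; exact hbound y hy) hlim
      rw [ContinuousWithinAt, hΦ0]
      exact ht
    · have hxI : x ∈ Ioc 0 (L / 2) := ⟨h0, hx.2⟩
      have hcq : ContinuousAt q x :=
        ((Real.continuous_cos.comp (by fun_prop)).continuousAt).div
          ((Real.continuous_sin.comp (by fun_prop)).continuousAt) (hsin_pos x hxI).ne'
      exact (((hθ.continuous.mul hω.continuous).continuousAt).mul
        (hu1.continuous.continuousAt.mul hcq)).continuousWithinAt
  -- (2) `Φ' = (θ'ω + θω') (u q) + θ ω V'` on `(0, ½L)`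
  have hΦderiv : ∀ x ∈ Ioo 0 (L / 2), HasDerivAt Φ
      (u x * (deriv θ x * ω x + θ x * deriv ω x) * q x + θ x * ω x * V' x) x := by
    intro x hx
    have hθd : HasDerivAt θ (deriv θ x) x :=
      ((hθ.differentiable (by norm_num)).differentiableAt).hasDerivAt
    have hωd : HasDerivAt ω (deriv ω x) x :=
      ((hω.differentiable (by norm_num)).differentiableAt).hasDerivAt
    have huqd : HasDerivAt (fun y => u y * q y) (V' x) x := by
      have h := hasDerivAt_periodicHLVelocity_mul_cot hL hω hper hx
      refine (h.congr_of_eventuallyEq (Eventually.of_forall fun y => ?_)).congr_deriv ?_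
      · simp only [hcotq, hu]
      · simp only [hV', hcotq, hu]
    have h : HasDerivAt (fun y => θ y * ω y * (u y * q y))
        ((deriv θ x * ω x + θ x * deriv ω x) * (u x * q x) + θ x * ω x * V' x) x :=
      (hθd.mul hωd).mul huqd
    refine h.congr_deriv ?_
    ring
  -- (3) integrate
  have hΦ'int : IntervalIntegrable (fun x => u x * (deriv θ x * ω x + θ x * deriv ω x) * q x +
      θ x * ω x * V' x) volume 0 (L / 2) := hLint.add hRint
  have hFTC := intervalIntegral.integral_eq_sub_of_hasDerivAt_of_le hL2 hΦcont hΦderiv hΦ'int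
  have hΦL : Φ (L / 2) = 0 := by
    simp only [hΦ, hq]
    rw [show π * (L / 2) / L = π / 2 by field_simp, Real.cos_pi_div_two]
    simp
  rw [hΦL, hΦ0, sub_zero, intervalIntegral.integral_add hLint hRint] at hFTC
  have hV'eq : ∀ x, θ x * ω x * V' x = θ x * ω x *
      (deriv u x * q x - π / L * u x / Real.sin (π * x / L) ^ 2) := fun x => rfl
  simp_rw [hV'eq] at hFTC
  linarith

end ChoiEtAl2017

end Literature.Analysis.FluidPDE
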